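import Literature.Topology.FourManifolds.MappingTorus
import Literature.Topology.FourManifolds.MappingTorusProofs
import Literature.Topology.FourManifolds.CircleSurgery
import Literature.Topology.FourManifolds.DehnSurgery
import Literature.Topology.FourManifolds.DehnSurgeryProofs
import Literature.Topology.FourManifolds.DehnSurgeryFramingProofs
import Literature.Topology.FourManifolds.KnotGroupAbelianization
import Literature.Topology.FourManifolds.Knots
import Literature.AlgebraicTopology.FundamentalGroup.CircleAndTorus
import Literature.Topology.FourManifolds.FibredKnot
import HarnessLib

/-!
# Stub `stub_pageFraming` of line `monodromy-kernel-engine` for crux `ZeroSurgeryExotic.ZseCruxRasmussen`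
(item stmt-SmoothPoincare4-0366, route `route-SmoothPoincare4-ZeroSurgeryExotic`)

**The binding neighbourhood of a fibred knot has framing `0`.** If the knot complement `S³ ∖ K`
is a smooth mapping torus of a self-diffeomorphism `θ` of the punctured fibre `F ∖ {p}`
(`IsOpenGluingWith … (mappingTorusRel θ) jA jB`) which, on a punctured disc chart at the puncture,
is the standard open book of the oriented tubular neighbourhood `ν` (`FibresWithVia K ν F p φ`),
then `ν.HasFraming 0`: the longitude of `ν` is null-homologous in `S³ ∖ K`.

Proof (algebraic, through the bundle projection; Rolfsen, *Knots and Links* (1976), §10.K: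
the longitude of a fibred knot lies on a page). The gluing maps `jA : (F ∖ {p}) × (0, 1) → S³ ∖ K`,
`jB : (F ∖ {p}) × (1/2, 3/2) → S³ ∖ K` are open topological embeddings covering the complement and
identifying exactly the `mappingTorusRel θ`-related points, whose levels differ by `0` or `1`; so
`jA (y, s) ↦ [s]`, `jB (y, t) ↦ [t]` is a well-defined continuous **bundle projection**
`P : S³ ∖ K → ℝ/ℤ` (the pattern of `nonempty_homeomorph_mappingTorus_of_isOpenEmbedding`,
`MappingTorusProofs.lean`). By the open-book clause the meridian `t ↦ ν (x₀, ½ e^{2πit})` of `ν`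
is `t ↦ jA (d (½ x₀), t)`, so `P ∘ μ` is the loop `t ↦ [t]` winding once around `ℝ/ℤ`
(`addCircleLoop`), while the longitude `t ↦ ν (e^{2πit}, ½ x₀) = jB (d (½ e^{2πit}), 1)` lies on
the page of angle `1`, so `P ∘ λ` is constant. Push forward along `P` to `π₁(ℝ/ℤ) ≅ ℤ`
(`fundamentalGroupAddCircleEquiv`, Hatcher Thm. 1.7, in the tree), an abelian group, hence through
the abelianised knot group: `λᵃᵇ = (μᵃᵇ)^m` for the framing integer `m` of `ν`
(`Knot.TubularNbhd.exists_hasFraming`, Crowell–Fox VIII (1.1)) maps to `0 = m · 1`, so `m = 0`.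

The predicate is the Literature definition `Knot.FibresWithVia` (`FibredKnot.lean`, definition item
`defn-Knot.FibresWithVia`, landed 2026-08-16), opened so that the registered stub signature reads letter for
letter; this theorem is the WANTED named fact "page framing = Seifert framing" listed in that file's header.
-/

noncomputable section

set_option linter.dupNamespace false

open scoped Manifold ContDiff Topology
open Set Function Literature.Topology.FourManifolds Literature.AlgebraicTopology.FundamentalGroup
open Literature.Topology.FourManifolds.Knot

namespace Summit.SmoothPoincare4.SmoothPoincare4.Theorems.ZseCruxRasmussen.MonodromyKernelEngine

/-- Local notation: `𝔼 n = ℝⁿ` (model vector space). -/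
local notation "𝔼 " n:arg => EuclideanSpace ℝ (Fin n)

/-- Local notation: `𝕊 n`, the unit sphere in `ℝⁿ⁺¹`. -/
local notation "𝕊 " n:arg => (Metric.sphere (0 : EuclideanSpace ℝ (Fin (n + 1))) 1)

/-! ## The bundle projection of a two-cylinder atlas -/

/-- **The bundle projection of a mapping torus presented by two cylinders.** If `T` is covered by
open topological embeddings `jA : M × (0, 1) → T`, `jB : M × (1/2, 3/2) → T` identifying exactly
the `mappingTorusRel θ`-related points, then `jA (y, s) ↦ [s]`, `jB (y, t) ↦ [t]` is a well-defined
continuous map `T → ℝ/ℤ` (related points have levels differing by `0` or `1`; continuity is local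
along the open embeddings). This is the projection `MappingTorus.proj` read through the comparison
of `nonempty_homeomorph_mappingTorus_of_isOpenEmbedding` (Hatcher, *Algebraic Topology*, Ex. 2.48).
[cite: HatcherAT2002, Ex. 2.48] -/
theorem exists_bundleProjection {M T : Type*} [TopologicalSpace M] [TopologicalSpace T]
    (θ : M → M) {jA : M × ↥mappingTorusPieceOne → T} {jB : M × ↥mappingTorusPieceTwo → T}
    (hA : Topology.IsOpenEmbedding jA) (hB : Topology.IsOpenEmbedding jB)
    (hU : range jA ∪ range jB = univ) (hR : ∀ a b, jA a = jB b ↔ mappingTorusRel θ a b) :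
    ∃ P : C(T, AddCircle (1 : ℝ)),
      (∀ a, P (jA a) = ((a.2 : ℝ) : AddCircle (1 : ℝ))) ∧
      (∀ b, P (jB b) = ((b.2 : ℝ) : AddCircle (1 : ℝ))) := by
  classical
  have hcover : ∀ p, p ∈ range jA ∨ p ∈ range jB := fun p => by
    simpa only [← mem_union, hU] using mem_univ p
  set qA : M × ↥mappingTorusPieceOne → AddCircle (1 : ℝ) :=
    fun a => ((a.2 : ℝ) : AddCircle (1 : ℝ)) with hqA_def
  set qB : M × ↥mappingTorusPieceTwo → AddCircle (1 : ℝ) :=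
    fun b => ((b.2 : ℝ) : AddCircle (1 : ℝ)) with hqB_def
  have hqAB : ∀ a b, jA a = jB b → qA a = qB b := by
    intro a b h
    rcases (hR a b).1 h with ⟨h2, -⟩ | ⟨h2, -⟩
    · simp only [hqA_def, hqB_def, h2]
    · simp only [hqA_def, hqB_def, h2, AddCircle.coe_add_period]
  set f : T → AddCircle (1 : ℝ) := fun p =>
    if h : p ∈ range jA then qA (Classical.choose h)
    else qB (Classical.choose ((hcover p).resolve_left h)) with hf_def
  have hfA : ∀ a, f (jA a) = qA a := fun a => by
    have h : jA a ∈ range jA := mem_range_self a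
    rw [hf_def]
    dsimp only
    rw [dif_pos h]
    congr 1
    exact hA.injective (Classical.choose_spec h)
  have hfB : ∀ b, f (jB b) = qB b := fun b => by
    by_cases h : jB b ∈ range jA
    · obtain ⟨a, ha⟩ := h
      rw [← ha, hfA]
      exact hqAB a b ha
    · rw [hf_def]
      dsimp only
      rw [dif_neg h]
      congr 1
      exact hB.injective (Classical.choose_spec ((hcover (jB b)).resolve_left h))
  have hfA' : f ∘ jA = qA := funext hfA
  have hfB' : f ∘ jB = qB := funext hfB
  have hqAc : Continuous qA :=
    (AddCircle.continuous_mk' (1 : ℝ)).comp (continuous_subtype_val.comp continuous_snd)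
  have hqBc : Continuous qB :=
    (AddCircle.continuous_mk' (1 : ℝ)).comp (continuous_subtype_val.comp continuous_snd)
  have hcont : Continuous f := by
    refine continuous_iff_continuousAt.2 fun p => ?_
    obtain ⟨a, rfl⟩ | ⟨b, rfl⟩ := hcover p
    · exact hA.continuousAt_iff.1 (hfA' ▸ hqAc.continuousAt)
    · exact hB.continuousAt_iff.1 (hfB' ▸ hqBc.continuousAt)
  exact ⟨⟨f, hcont⟩, hfA, hfB⟩

/-! ## Stub 1 — the page framing is the Seifert framing -/

/-- **Page framing = `0`-framing.** If `K` fibres through `ν` (`FibresWithVia K ν F p φ`), then `ν`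
has framing `0`. Along the bundle projection `P : S³ ∖ K → ℝ/ℤ` of the mapping-torus structure of
the complement (`exists_bundleProjection`), the meridian of `ν` — which by the standard-open-book
clause turns the pages once, `μ(t) = jA (d (½ x₀), t)` — maps to the generator `t ↦ [t]` of
`π₁(ℝ/ℤ) ≅ ℤ` (Hatcher Thm. 1.7, `fundamentalGroupAddCircleEquiv_addCircleLoop`), while the
longitude `λ(t) = ν (e^{2πit}, ½ x₀) = jB (d (½ e^{2πit}), 1)` lies on ONE page and maps to a
constant loop. Since `π₁(ℝ/ℤ)` is abelian, `P_*` factors through `π₁(S³ ∖ K)ᵃᵇ`, where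
`λᵃᵇ = (μᵃᵇ)^m` for the framing integer `m` of `ν` (`Knot.TubularNbhd.exists_hasFraming`,
Crowell–Fox VIII (1.1)); applying `P_*` gives `0 = m`, i.e. `ν.HasFraming 0`. This is the
statement that the longitude of a fibred knot is a fibre boundary (Rolfsen, *Knots and Links*,
§10.K; Burde–Zieschang, *Knots*, Ch. 5), proved through the fibration rather than through a
Seifert surface. [cite: Rolfsen1976, §10.K] -/
theorem stub_pageFraming :
    ∀ (K : Knot) (ν : Knot.TubularNbhd K) (F : Type) [TopologicalSpace F] [T2Space F]
      [SecondCountableTopology F] [ChartedSpace (𝔼 2) F] [IsManifold (𝓡 2) ∞ F] [CompactSpace F]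
      [ConnectedSpace F] (p : F) (φ : F ≃ₘ⟮𝓡 2, 𝓡 2⟯ F),
      FibresWithVia K ν F p φ → ν.HasFraming 0 := by
  intro K ν F _ _ _ _ _ _ _ p φ hfib
  obtain ⟨θ, jA, jB, d, -, ⟨hA, hAo, hB, hBo, hU, hR⟩, hd, -, hd0, hbook⟩ := hfib
  -- the bundle projection `P : S³ ∖ K → ℝ/ℤ`
  obtain ⟨P, hPA, hPB⟩ :=
    exists_bundleProjection (⇑θ) ⟨hA.isEmbedding, hAo⟩ ⟨hB.isEmbedding, hBo⟩ hU hR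
  -- the circle of radius `1/2` of the disc chart lies in the punctured surface
  have hdinj : Injective d := hd.isEmbedding.injective
  have hmem : ∀ u : 𝕊 1, d ((1 / 2 : ℝ) • ((u : 𝕊 1) : 𝔼 2)) ∈ punctureAt p := by
    intro u
    change d _ ∈ ({p}ᶜ : Set F)
    rw [mem_compl_singleton_iff, ← hd0]
    exact fun h => half_smul_coe_sphere_ne_zero u (hdinj h)
  have hhalf : (1 / 2 : ℝ) ∈ Ioo (0 : ℝ) 1 := by norm_num
  have h1B : (1 : ℝ) ∈ mappingTorusPieceTwo := by
    rw [← SetLike.mem_coe, coe_mappingTorusPieceTwo]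
    norm_num
  -- the open-book clause at radius `1/2`
  have hbk : ∀ u : 𝕊 1,
      (∀ s : ↥mappingTorusPieceOne,
        ((jA (⟨d ((1 / 2 : ℝ) • ((u : 𝕊 1) : 𝔼 2)), hmem u⟩, s) : ↥K.complement) : 𝕊 3) =
          ν (u, (1 / 2 : ℝ) • ((circlePoint (2 * Real.pi * (s : ℝ)) : 𝕊 1) : 𝔼 2))) ∧
      (∀ t : ↥mappingTorusPieceTwo,
        ((jB (⟨d ((1 / 2 : ℝ) • ((u : 𝕊 1) : 𝔼 2)), hmem u⟩, t) : ↥K.complement) : 𝕊 3) =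
          ν (u, (1 / 2 : ℝ) • ((circlePoint (2 * Real.pi * (t : ℝ)) : 𝕊 1) : 𝔼 2))) :=
    fun u => hbook ⟨d ((1 / 2 : ℝ) • ((u : 𝕊 1) : 𝔼 2)), hmem u⟩ u (1 / 2) hhalf rfl
  -- the page of angle `1` through the tube at radius `1/2` is the push-off annulus
  have hc1 : ∀ u : 𝕊 1,
      ((jB (⟨d ((1 / 2 : ℝ) • ((u : 𝕊 1) : 𝔼 2)), hmem u⟩, ⟨1, h1B⟩) : ↥K.complement) : 𝕊 3) =
        ν (u, framingBaseVector) := by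
    intro u
    rw [(hbk u).2 ⟨1, h1B⟩]
    change ν (u, (1 / 2 : ℝ) • ((circlePoint (2 * Real.pi * 1) : 𝕊 1) : 𝔼 2)) = _
    rw [Literature.Topology.FourManifolds.circlePoint_two_pi_mul_one]
    rfl
  have hbase : ν.basePoint =
      jB (⟨d ((1 / 2 : ℝ) • (((circlePoint 0 : 𝕊 1) : 𝕊 1) : 𝔼 2)), hmem _⟩, ⟨1, h1B⟩) :=
    Subtype.ext (by rw [hc1]; rfl)
  have hPbase : P ν.basePoint = ((1 : ℝ) : AddCircle (1 : ℝ)) := by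
    rw [hbase, hPB]
  -- `P ∘ longitude` is constant
  have hlong : ∀ t : unitInterval, P (ν.longitude t) = ((1 : ℝ) : AddCircle (1 : ℝ)) := by
    intro t
    have ht : ν.longitude t =
        jB (⟨d ((1 / 2 : ℝ) • (((circlePoint (2 * Real.pi * t) : 𝕊 1) : 𝕊 1) : 𝔼 2)), hmem _⟩,
          ⟨1, h1B⟩) :=
      Subtype.ext (by rw [hc1]; rfl)
    rw [ht, hPB]
  -- `P ∘ meridian` is `t ↦ [t]`
  have hmer : ∀ t : unitInterval, P (ν.meridian t) = ((t : ℝ) : AddCircle (1 : ℝ)) := by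
    intro t
    by_cases ht : (t : ℝ) ∈ Ioo (0 : ℝ) 1
    · have hmt : ν.meridian t =
          jA (⟨d ((1 / 2 : ℝ) • (((circlePoint 0 : 𝕊 1) : 𝕊 1) : 𝔼 2)), hmem _⟩, ⟨t, ht⟩) :=
        Subtype.ext (by rw [(hbk (circlePoint 0)).1 ⟨t, ht⟩]; rfl)
      rw [hmt, hPA]
    · have ht' : t = 0 ∨ t = 1 := by
        rcases t with ⟨t, ht0, ht1⟩
        simp only [mem_Ioo, not_and_or, not_lt] at ht
        rcases ht with ht | ht
        · exact Or.inl (Subtype.ext (le_antisymm ht ht0))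
        · exact Or.inr (Subtype.ext (le_antisymm ht1 ht))
      rcases ht' with rfl | rfl
      · rw [ν.meridian.source, hPbase, Set.Icc.coe_zero, AddCircle.coe_period,
          QuotientAddGroup.mk_zero]
      · rw [ν.meridian.target, hPbase, Set.Icc.coe_one]
  -- pushforward of the meridian and of the longitude along `P`
  have hpathM : ν.meridian.map P.continuous = addCircleLoop 1 (P ν.basePoint) := by
    ext t
    change P (ν.meridian t) = _
    rw [addCircleLoop_apply, hmer, hPbase, mul_one, AddCircle.coe_period, zero_add]
  have hpathL : ν.longitude.map P.continuous = Path.refl (P ν.basePoint) := by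
    ext t
    change P (ν.longitude t) = P ν.basePoint
    rw [hlong, hPbase]
  have hfM : FundamentalGroup.map P ν.basePoint
      (FundamentalGroup.fromPath (Path.Homotopic.Quotient.mk ν.meridian)) =
        FundamentalGroup.fromPath
          (Path.Homotopic.Quotient.mk (addCircleLoop 1 (P ν.basePoint))) := by
    change FundamentalGroup.fromPath (Path.Homotopic.Quotient.mk (ν.meridian.map P.continuous)) = _
    rw [hpathM]
  have hfL : FundamentalGroup.map P ν.basePoint
      (FundamentalGroup.fromPath (Path.Homotopic.Quotient.mk ν.longitude)) = 1 := by
    change FundamentalGroup.fromPath (Path.Homotopic.Quotient.mk (ν.longitude.map P.continuous)) =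
      FundamentalGroup.fromPath (Path.Homotopic.Quotient.mk (Path.refl _))
    rw [hpathL]
  -- the framing integer exists; push it to `π₁(ℝ/ℤ) ≅ ℤ`
  obtain ⟨m, hm⟩ := ν.exists_hasFraming
  obtain rfl : m = 0 := by
    set g : FundamentalGroup (↥K.complement) ν.basePoint →* Multiplicative ℤ :=
      (fundamentalGroupAddCircleEquiv (p := (1 : ℝ)) one_ne_zero (P ν.basePoint)).toMonoidHom.comp
        (FundamentalGroup.map P ν.basePoint) with hg
    have hgM : g (FundamentalGroup.fromPath (Path.Homotopic.Quotient.mk ν.meridian)) =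
        Multiplicative.ofAdd (1 : ℤ) := by
      rw [hg, MonoidHom.comp_apply, MulEquiv.coe_toMonoidHom, hfM]
      exact fundamentalGroupAddCircleEquiv_addCircleLoop one_ne_zero _
    have hgL : g (FundamentalGroup.fromPath (Path.Homotopic.Quotient.mk ν.longitude)) = 1 := by
      rw [hg, MonoidHom.comp_apply, MulEquiv.coe_toMonoidHom, hfL, map_one]
    have hm' : Abelianization.of (FundamentalGroup.fromPath (Path.Homotopic.Quotient.mk ν.longitude)) =
        Abelianization.of (FundamentalGroup.fromPath (Path.Homotopic.Quotient.mk ν.meridian)) ^ m :=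
      hm
    have key := congrArg (Abelianization.lift g) hm'
    rw [map_zpow, Abelianization.lift_apply_of, Abelianization.lift_apply_of, hgM, hgL,
      ← ofAdd_zsmul, smul_eq_mul, mul_one] at key
    exact ofAdd_eq_one.1 key.symm
  exact hm

end Summit.SmoothPoincare4.SmoothPoincare4.Theorems.ZseCruxRasmussen.MonodromyKernelEngine

end
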